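import Summits.HodgeConjecture.HodgeConjecture.Theses.SiuRepresentability
import Literature.AlgebraicGeometry.HodgeTheory.SupportedHodgeClassesAlgebraic
import Literature.AlgebraicGeometry.HodgeTheory.SaitoGrFDeRhamCurveNetHolds
import Literature.AlgebraicGeometry.Resolution.ProjectiveResolutionProofs
import Literature.AlgebraicGeometry.HodgeTheory.CanonicalTrace
import Literature.AlgebraicGeometry.HodgeTheory.ComplexGysin
import Literature.AlgebraicGeometry.HodgeTheory.ComplexOrientationFamily
import HarnessLib

/-!
# Route `SiuRepresentability` — support item `AlgebraicClassesRepresentable` (stmt-HodgeConjecture-9030), PROVED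

**Algebraic classes are representable by smooth projective varieties.** On a smooth projective `n`-fold `X`,
`p + k = n`, every class of `Nᵖ H²ᵖ(X(ℂ); ℂ) = algebraicClasses X p` lies in the `ℂ`-span of the classes `c'`
with `c' ⌢ [X(ℂ)]_{μX} = f_* [M(ℂ)]_{μM}` for some `ℂ`-orientations `μX`, `μM`, some smooth projective `k`-fold
`M` and some continuous `f : M(ℂ) → X(ℂ)`.

Proof (Hironaka + Deligne Cor. 8.2.8, both THEOREMS of the tree).  A class of `Nᵖ H²ᵖ` dies off one closed
`Z ⊆ X` of codimension `≥ p` (`exists_support_of_mem_supportedClasses`); `Z = ⋃ⱼ gⱼ(Yⱼ)` with `Yⱼ` smooth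
projective of dimension `mⱼ ≤ n − p = k` (`exists_family_iUnion_range_eq_of_isClosed`, projective Hironaka
`Resolution.Hironaka1964_projective_holds`); by Deligne's Cor. 8.2.8
(`Deligne1974_ker_restrictCompl_eq_iSup_range_complexGysin_holds`, through `mem_iSup_range`) the class is a
sum of Gysin images `(gⱼ)_* yⱼ`, `yⱼ ∈ H^{2p + 2mⱼ − 2n}(Yⱼ(ℂ))`, forcing `mⱼ = k` and degree `0`;
`H⁰(Yⱼ(ℂ); ℂ) = ℂ · 1` (`exists_eq_smul_one_of_isSmoothProjective`) and `(gⱼ)_* 1 ⌢ [X(ℂ)] = gⱼ(ℂ)_* [Yⱼ(ℂ)]`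
for the complex orientation family (`capProduct_complexGysin_one`).  No definition, no named-fact hypothesis,
no sorry.
-/

noncomputable section

-- every declaration of this problem lives in `Summit.HodgeConjecture.HodgeConjecture.…` (summit = sub-problem)
set_option linter.dupNamespace false

namespace Summit.HodgeConjecture.HodgeConjecture.Theorems.AlgebraicClassesRepresentable

open CategoryTheory AlgebraicGeometry
open Literature.AlgebraicGeometry Literature.AlgebraicGeometry.Motives Literature.AlgebraicGeometry.HodgeTheory
open Literature.AlgebraicTopology.SingularHomology

variable {n : ℕ} {X : SchemeOver ℂ}

/-- **One Gysin piece is representable.** For `g : Y ⟶ X` with `Y` smooth projective of dimension `d ≤ n − p`,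
every Gysin image `g_* y ∈ H²ᵖ(X(ℂ); ℂ)` (complex orientation family) lies in the span of the classes Poincaré
dual to images of fundamental classes of smooth projective `k`-folds (`p + k = n`): the degree count forces
`d = k` and `y ∈ H⁰(Y(ℂ); ℂ) = ℂ · 1`, and `g_* 1 ⌢ [X(ℂ)] = g(ℂ)_* [Y(ℂ)]`.
[cite: FultonYoungTableaux1997, Appendix B §B.1 (5) and §B.3] [cite: VoisinHodgeI2002, §11.1.2] -/
theorem complexGysin_mem_span_representable (hX : IsSmoothProjective n X) {p k : ℕ} (hpk : p + k = n)
    {d : ℕ} {Y : SchemeOver ℂ} (hY : IsSmoothProjective d Y) (g : Y ⟶ X) (hd : d + p ≤ n) {a : ℕ}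
    (hab : a + 2 * n = 2 * p + 2 * d) (y : complexBetti Y a) :
    complexGysin complexOrientationFamily hY hX g hab y ∈
      Submodule.span ℂ {c' : complexBetti X (2 * p) |
        ∃ (μX : HomologicalOrientation ℂ (ComplexPoints X) (2 * n)) (M : SchemeOver ℂ)
          (_ : IsSmoothProjective k M) (μM : HomologicalOrientation ℂ (ComplexPoints M) (2 * k))
          (f : C(ComplexPoints M, ComplexPoints X)),
          capProduct (show 2 * p + 2 * k = 2 * n by omega) c' μX.fundamentalClass =
            singularHomology.map ℂ ℂ f (2 * k) μM.fundamentalClass} := by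
  obtain rfl : d = k := by omega
  obtain rfl : a = 0 := by omega
  obtain ⟨t, rfl⟩ := exists_eq_smul_one_of_isSmoothProjective hY ℂ y
  rw [map_smul]
  refine Submodule.smul_mem _ _ (Submodule.subset_span ?_)
  exact ⟨complexOrientationFamily hX, Y, hY, complexOrientationFamily hY, AlgPoints.mapContinuous (L := ℂ) g,
    capProduct_complexGysin_one hasPoincareDuality_complexOrientationFamily hY hX g (by omega)⟩

end Summit.HodgeConjecture.HodgeConjecture.Theorems.AlgebraicClassesRepresentable

namespace Summit.HodgeConjecture.HodgeConjecture.Theorems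

open CategoryTheory AlgebraicGeometry
open Literature.AlgebraicGeometry Literature.AlgebraicGeometry.Motives Literature.AlgebraicGeometry.HodgeTheory
open Literature.AlgebraicTopology.SingularHomology

/-- **Item stmt-HodgeConjecture-9030 (`AlgebraicClassesRepresentable`, route `SiuRepresentability`)**: on every
smooth projective `n`-fold, `p + k = n`, `Nᵖ H²ᵖ(X(ℂ); ℂ)` is spanned by classes Poincaré dual to images
`f_* [M(ℂ)]` of fundamental classes of smooth projective `k`-folds — Hironaka + Deligne Cor. 8.2.8 + degree
count.  The type is literally the route decl
`Summit.HodgeConjecture.HodgeConjecture.Theses.SiuRepresentability.AlgebraicClassesRepresentable`.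
[cite: Hironaka1964, Main Theorem I] [cite: DeligneHodgeIII1974, Cor. 8.2.8] [cite: VoisinHodgeI2002, §11.1.2]
[cite: FultonYoungTableaux1997, Appendix B §B.3] -/
theorem siuRepresentability_algebraicClassesRepresentable_proof :
    Summit.HodgeConjecture.HodgeConjecture.Theses.SiuRepresentability.AlgebraicClassesRepresentable := by
  intro n X hX p k hpk c hc
  -- one closed support of codimension `≥ p`
  obtain ⟨Z, hZ, hZp, hcZ⟩ := exists_support_of_mem_supportedClasses hc
  -- resolve its components: `Z = ⋃ⱼ gⱼ(Yⱼ)`, `dim Yⱼ + p ≤ n`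
  obtain ⟨ι, hι, m, Y, hY, g, hZeq, hm⟩ :=
    exists_family_iUnion_range_eq_of_isClosed Resolution.Hironaka1964_projective_holds hX hZ hZp
  haveI := hι
  subst hZeq
  -- Deligne: `c ∈ Σⱼ im (gⱼ)_*` for the complex orientation family
  have hmem := Deligne1974_ker_restrictCompl_eq_iSup_range_complexGysin.mem_iSup_range
    Deligne1974_ker_restrictCompl_eq_iSup_range_complexGysin_holds complexOrientationFamily
    hasPoincareDuality_complexOrientationFamily hX hY g hcZ
  refine SetLike.le_def.mp (iSup_le fun j ↦ iSup_le fun a ↦ iSup_le fun hab ↦ ?_) hmem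
  rintro _ ⟨y, rfl⟩
  exact AlgebraicClassesRepresentable.complexGysin_mem_span_representable hX hpk (hY j) (g j) (hm j) hab y

end Summit.HodgeConjecture.HodgeConjecture.Theorems

end
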